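import Literature.Geometry.Lorentzian.HypersurfaceMomentumConstraint
import Literature.Geometry.Lorentzian.GaussFormulaTangentialGeneral
import Literature.Geometry.Lorentzian.MetricAdjointTrace
import Literature.Geometry.Lorentzian.DivergenceTheorem
import Literature.Geometry.Lorentzian.EinsteinProofs
import Literature.Geometry.Lorentzian.LeviCivitaCovDerivProofs
import HarnessLib

/-!
# The divergence of a contracted tensor, `div ♯(k(·, Z)) = (div k)(Z) + ⟨kᵗ, ∇Z⟩`, and the
# Sudarsky–Wald integrand `D_i(K^{ij} Z_j) = -N K^{ij} K_{ij}` on a maximal vacuum slice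

For a field of bilinear forms `k` and vector fields `Z`, `W` on `(M, g)` with `g(W, ·) = k(·, Z)`
(i.e. `W = ♯(k(·, Z))`, `W^j = k^j{}_l Z^l`), all differentiable at `x`:

  `div W (x) = (div k)_x(Z_x) + tr(♯kᵗ_x ∘ ∇Z(x))`,   i.e. `∇_j(k^j{}_l Z^l) = (∇_j k^j{}_l) Z^l + k^{jl} ∇_j Z_l`

(`PseudoRiemannianMetric.vectorDivergence_sharp_contract`; O'Neill 1983, Ch. 3, p. 86, divergence
as contraction of the covariant differential, with the product rule Ch. 2, Thm. 2.15). The proof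
is the printed one: `g(∇_v W, u) = v(k(U, Z)) - k(∇_v U, Z)` by metric compatibility for an
extension `U` of `u`, `= (∇_v k)(u, Z) + k(u, ∇_v Z)` by the definition of `∇k`
(`covDeriv₂_apply_holds`), then the metric trace (`trace_endo_eq_trace_val`, `trace_flip`).

Application (Chruściel–Costa 2008, §7.2, the display after (7.1)): on a spacelike hypersurface
`f : (N, h = f^*g) → (M, g)` with unit normal `ν`, second fundamental form `K`, along which a Killing
field splits as `X ∘ f = N ν + df Z`, one has (7.1) `D_i Z_j + D_j Z_i = -2N K_{ij}`
(`GaussFormulaTangentialGeneral.lean`), hence `K^{ij} D_i Z_j = -N |K|²`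
(`MetricAdjointTrace.lean`); if moreover the slice is **maximal** (`tr_h K ≡ 0`) and `g` is Ricci
flat at the point, the momentum constraint `div K = d(tr K) + Ric(df ·, ν) = 0`
(`HypersurfaceMomentumConstraint.lean`) gives

  `div_h ♯(K(·, Z)) = -N |K|²_h`   (`D_i(K^{ij} Z_j) = -N K^{ij} K_{ij}`)

(`PseudoRiemannianMetric.IsKillingField.vectorDivergence_sharp_secondFundamentalForm_shift`), the
integrand of Sudarsky–Wald's identity `∫_Σ N|K|² = 0` in the staticity theorem
(`NonRotatingBlackHoleUniqueness.lean`, `SudarskyWald1993_staticity`, step (S4) of the printed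
proof as mapped in `NonRotatingBlackHoleUniquenessProofs.lean`).

Everything is proved; no definitions, no named facts. Differentiability of `K` (as a section of
`Hom(TN, Hom(TN, ℝ))`) and of `W = ♯(K(·, Z))` at the point are hypotheses, as in
`HypersurfaceMomentumConstraint.lean`.

## References

* P. T. Chruściel, J. L. Costa, *On uniqueness of stationary vacuum black holes*, Astérisque 321
  (2008), arXiv:0806.0016, §7.2 (key `ChruscielCosta2008`).
* D. Sudarsky, R. M. Wald, *Mass formulas for stationary Einstein–Yang–Mills black holes and a
  simple proof of two staticity theorems*, Phys. Rev. D 47 (1993), R5209–R5213 (key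
  `SudarskyWald1993`).
* B. O'Neill, *Semi-Riemannian geometry with applications to relativity*, Academic Press 1983,
  Ch. 2, Thm. 2.15; Ch. 3, pp. 60–61, p. 86 (key `ONeill1983`).
-/

noncomputable section

open Bundle Set Filter Function Manifold FiberBundle
open scoped Manifold ContDiff Topology

namespace Literature.Geometry.Lorentzian

namespace PseudoRiemannianMetric

/-! ### Fibrewise trace lemmas -/

section Fibre

variable
  {EB : Type*} [NormedAddCommGroup EB] [NormedSpace ℝ EB]
  {HB : Type*} [TopologicalSpace HB] {IB : ModelWithCorners ℝ EB HB} {n : ℕ∞ω}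
  {B : Type*} [TopologicalSpace B] [ChartedSpace HB B]
  {F : Type*} [NormedAddCommGroup F] [NormedSpace ℝ F]
  {V : B → Type*} [TopologicalSpace (TotalSpace F V)]
  [∀ b, TopologicalSpace (V b)] [∀ b, AddCommGroup (V b)] [∀ b, Module ℝ (V b)]
  [FiberBundle F V] [VectorBundle ℝ F V] [FiniteDimensional ℝ F]
  (g : PseudoRiemannianMetric IB n F V) (b : B)

/-- **The trace of an endomorphism is the metric trace of its lowered form**:
`tr T = tr_g ((v, w) ↦ g(T v, w))` (the `♯`-image of that form is `T`). O'Neill 1983, Ch. 3,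
pp. 60–61. [cite: ONeill1983, Ch. 3, pp. 60–61] -/
theorem trace_endo_eq_trace_val (T : V b →ₗ[ℝ] V b) :
    LinearMap.trace ℝ (V b) T = g.trace b ((g.toBilinForm b).comp T LinearMap.id) := by
  set BT : LinearMap.BilinForm ℝ (V b) := (g.toBilinForm b).comp T LinearMap.id with hBT
  have hBT_apply : ∀ v w, BT v w = g.val b (T v) w := fun v w ↦ rfl
  have hsharp : (g.sharp b).toLinearMap ∘ₗ BT = T := by
    ext v
    rw [LinearMap.comp_apply, LinearEquiv.coe_coe]
    refine g.sharp_eq_of_forall b (BT v) (T v) fun w ↦ ?_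
    rw [hBT_apply]
  rw [PseudoRiemannianMetric.trace, hsharp]

/-- **The metric trace is invariant under transposition**: `tr_g Tᵗ = tr_g T`
(`g^{ij} T_{ji} = g^{ij} T_{ij}`): `♯Tᵗ` is the `g`-adjoint of `♯T` (`adjoint_sharp_comp`) and
adjoints have the same trace (`trace_adjoint`). O'Neill 1983, Ch. 3, pp. 60–61. [cite: ONeill1983, Ch. 3, pp. 60–61] -/
theorem trace_flip (T : LinearMap.BilinForm ℝ (V b)) : g.trace b T.flip = g.trace b T := by
  simp only [PseudoRiemannianMetric.trace]
  rw [← g.adjoint_sharp_comp b T, g.trace_adjoint b]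

end Fibre

/-! ### The divergence of `♯(k(·, Z))` -/

section Intrinsic

variable {E : Type*} [NormedAddCommGroup E] [NormedSpace ℝ E] {H : Type*} [TopologicalSpace H]
  {I : ModelWithCorners ℝ E H} {M : Type*} [TopologicalSpace M] [ChartedSpace H M]
  [IsManifold I ∞ M] [FiniteDimensional ℝ E] [CompleteSpace E]
  (g : PseudoRiemannianMetric I ∞ E (TangentSpace I : M → Type _)) [g.HasLeviCivita]

/-- **`g(∇_v W, u) = (∇_v k)(u, Z) + k(u, ∇_v Z)` for `W = ♯(k(·, Z))`.** For a field of bilinear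
forms `k`, vector fields `Z`, `W`, all differentiable at `x`, with `g(W, u) = k(u, Z)` identically:
metric compatibility along an extension `U` of `u` gives `g(∇_v W, u) = v(k(U, Z)) - g(W, ∇_v U)
= v(k(U, Z)) - k(∇_v U, Z)`, and `v(k(U, Z)) = (∇_v k)(u, Z) + k(∇_v U, Z) + k(u, ∇_v Z)` is the
definition of `∇k` (`covDeriv₂_apply_holds`). O'Neill 1983, Ch. 2, Thm. 2.15 and Ch. 3, Def. 3.17,
Thm. 3.11 (D4). [cite: ONeill1983, Ch. 3, Def. 3.17] -/
theorem val_leviCivita_sharp_contract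
    {k : Π y : M, TangentSpace I y →L[ℝ] TangentSpace I y →L[ℝ] ℝ} {x : M}
    (hk : MDifferentiableAt I (I.prod 𝓘(ℝ, E →L[ℝ] E →L[ℝ] ℝ))
      (fun y ↦ TotalSpace.mk' (E →L[ℝ] E →L[ℝ] ℝ)
        (E := fun y : M ↦ TangentSpace I y →L[ℝ] TangentSpace I y →L[ℝ] ℝ) y (k y)) x)
    {Z W : Π y : M, TangentSpace I y} (hZ : MDiffAt (T% Z) x) (hW : MDiffAt (T% W) x)
    (hWk : ∀ (y : M) (u : TangentSpace I y), g.val y (W y) u = k y u (Z y))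
    (v u : TangentSpace I x) :
    g.val x (g.leviCivita W x v) u = g.covDeriv₂ k x u (Z x) v + k x u (g.leviCivita Z x v) := by
  have hLC : g.IsLeviCivita g.leviCivita := isLeviCivita_leviCivita_holds
  have hU : MDiffAt (T% (FiberBundle.extend E u)) x := mdifferentiableAt_extend (I := I) (F := E) u
  have hV : MDiffAt (T% (FiberBundle.extend E v)) x := mdifferentiableAt_extend (I := I) (F := E) v
  -- metric compatibility along the extension of `v` for the pair `(W, U)`
  have hc := hLC.2 hV hW hU
  -- the definition of `∇k` on `(U, Z; V)`
  have hd := covDeriv₂_apply_holds (g := g) hk hU hZ hV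
  have hfun : (fun y ↦ g.val y (W y) (FiberBundle.extend E u y)) =
      fun y ↦ k y (FiberBundle.extend E u y) (Z y) := funext fun y ↦ hWk y _
  rw [hfun] at hc
  have hWU : g.val x (W x) (g.leviCivita (FiberBundle.extend E u) x v) =
      k x (g.leviCivita (FiberBundle.extend E u) x v) (Z x) := hWk x _
  simp only [covDeriv₂Aux, extend_apply_self] at hc hd
  linarith [hc, hd, hWU]

/-- **The divergence of a contracted tensor**: for `k`, `Z`, `W` as above (`W = ♯(k(·, Z))`,
`W^j = k^j{}_l Z^l`, all differentiable at `x`),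
`div W (x) = (div k)_x(Z_x) + tr(♯kᵗ_x ∘ ∇Z(x))`, i.e.
`∇_j (k^j{}_l Z^l) = (∇_j k^j{}_l) Z^l + k^{jl} ∇_j Z_l`: the trace of the previous lemma
(`trace_endo_eq_trace_val`; the first term is the metric trace of the transpose of
`divergenceAux k x (Z x)`, `trace_flip`; the second is `tr(♯ ∘ kᵗ ∘ ∇Z)`). O'Neill 1983, Ch. 3,
p. 86; this is the Leibniz rule behind "maximality of `Σ''` and the vacuum constraint give
`D_i(K^{ij} Z_j) = -N K^{ij}K_{ij}`" (Chruściel–Costa 2008, §7.2). [cite: ONeill1983, Ch. 3, p. 86] -/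
theorem vectorDivergence_sharp_contract
    {k : Π y : M, TangentSpace I y →L[ℝ] TangentSpace I y →L[ℝ] ℝ} {x : M}
    (hk : MDifferentiableAt I (I.prod 𝓘(ℝ, E →L[ℝ] E →L[ℝ] ℝ))
      (fun y ↦ TotalSpace.mk' (E →L[ℝ] E →L[ℝ] ℝ)
        (E := fun y : M ↦ TangentSpace I y →L[ℝ] TangentSpace I y →L[ℝ] ℝ) y (k y)) x)
    {Z W : Π y : M, TangentSpace I y} (hZ : MDiffAt (T% Z) x) (hW : MDiffAt (T% W) x)
    (hWk : ∀ (y : M) (u : TangentSpace I y), g.val y (W y) u = k y u (Z y)) :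
    g.vectorDivergence W x =
      g.divergence k x (Z x) +
        LinearMap.trace ℝ (TangentSpace I x)
          (((g.sharp x).toLinearMap ∘ₗ ((k x).toLinearMap₁₂).flip) ∘ₗ
            ((g.leviCivita Z x : TangentSpace I x →L[ℝ] TangentSpace I x) :
              TangentSpace I x →ₗ[ℝ] TangentSpace I x)) := by
  haveI : FiniteDimensional ℝ (TangentSpace I x) := inferInstanceAs (FiniteDimensional ℝ E)
  have step1 := g.val_leviCivita_sharp_contract hk hZ hW hWk
  rw [vectorDivergence_def, g.trace_endo_eq_trace_val x]
  have hBT : (g.toBilinForm x).comp ((g.leviCivita W x : TangentSpace I x →L[ℝ] TangentSpace I x) :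
      TangentSpace I x →ₗ[ℝ] TangentSpace I x) LinearMap.id =
      (g.divergenceAux k x (Z x)).flip +
        LinearMap.BilinForm.comp ((k x).toLinearMap₁₂).flip ((g.leviCivita Z x :
          TangentSpace I x →L[ℝ] TangentSpace I x) : TangentSpace I x →ₗ[ℝ] TangentSpace I x)
          LinearMap.id := by
    refine LinearMap.ext₂ fun v u ↦ ?_
    simp only [LinearMap.BilinForm.comp_apply, LinearMap.id_coe, id_eq, ContinuousLinearMap.coe_coe,
      LinearMap.add_apply, LinearMap.flip_apply, ContinuousLinearMap.toLinearMap₁₂_apply,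
      toBilinForm_apply]
    exact step1 v u
  rw [hBT, trace_add, trace_flip, ← divergence_apply]
  congr 1

end Intrinsic

/-! ### The Sudarsky–Wald integrand on a maximal vacuum slice -/

section Slice

variable {E : Type*} [NormedAddCommGroup E] [NormedSpace ℝ E] {H : Type*} [TopologicalSpace H]
  {I : ModelWithCorners ℝ E H} {M : Type*} [TopologicalSpace M] [ChartedSpace H M]
  [IsManifold I ∞ M] [FiniteDimensional ℝ E] [CompleteSpace E]
  (g : PseudoRiemannianMetric I ∞ E (TangentSpace I : M → Type _)) [g.HasLeviCivita]
  {E' : Type*} [NormedAddCommGroup E'] [NormedSpace ℝ E'] {H' : Type*} [TopologicalSpace H']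
  {I' : ModelWithCorners ℝ E' H'} {N : Type*} [TopologicalSpace N] [ChartedSpace H' N]
  [IsManifold I' ∞ N] [FiniteDimensional ℝ E'] [CompleteSpace E'] [I'.Boundaryless] {f : N → M}
  (hpb : contMDiff_pullbackBilin I M I' N ∞) (hfi : g.IsSpacelikeImmersion I' f)

/-- **`K^{ij} D_i Z_j = -N |K|²` from (7.1).** On a spacelike hypersurface `f : (N, h) → (M, g)`
with unit normal `ν` (smooth lift, sign `ε ≠ 0`) along which a Killing field splits as
`X ∘ f = N ν + df Z` (lapse `N = Nf`, shift `Z`), the contraction of the second fundamental form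
`K` with `∇Z` is `tr(♯K_{y} ∘ ∇Z(y)) = -Nf(y) |K_y|²_h`: (7.1)
`h(∇_u Z, w) + h(∇_w Z, u) = -2 Nf K(u, w)`
(`IsKillingField.inducedMetric_val_leviCivita_shift_symm_add`) and the trace identity
`tr(♯K ♯B) = (c/2)|K|²` for `B + Bᵗ = cK` (`trace_sharp_comp_sharp_of_add_flip_eq`) with
`B(u, w) = h(∇_u Z, w)`, `♯B = ∇Z`. Chruściel–Costa 2008, §7.2. [cite: ChruscielCosta2008, §7.2 (7.1)] -/
theorem IsKillingField.trace_sharp_secondFundamentalForm_comp_leviCivita_shift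
    {ν : NormalField I f} {ε : ℝ}
    (hν : ContMDiff I' I.tangent ∞ (fun x ↦ (TotalSpace.mk' E (f x) (ν x) : TangentBundle I M)))
    (hun : g.IsUnitNormal I' f ν ε)
    {X : Π x : M, TangentSpace I x} (hX : g.IsKillingField X)
    {Nf : N → ℝ} (hNd : ∀ y, MDifferentiableAt I' 𝓘(ℝ, ℝ) Nf y)
    {Z : Π y : N, TangentSpace I' y} (hZ : ∀ y, MDiffAt (T% Z) y)
    (hsplit : ∀ y, X (f y) = Nf y • ν y + mfderiv I' I f y (Z y)) (y₀ : N) :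
    haveI := (g.inducedMetric f hpb hfi).hasLeviCivita
    LinearMap.trace ℝ (TangentSpace I' y₀)
        (((g.inducedMetric f hpb hfi).sharp y₀).toLinearMap ∘ₗ g.secondFundamentalForm I' f ν y₀ ∘ₗ
          (((g.inducedMetric f hpb hfi).leviCivita Z y₀ :
              TangentSpace I' y₀ →L[ℝ] TangentSpace I' y₀) :
            TangentSpace I' y₀ →ₗ[ℝ] TangentSpace I' y₀)) =
      -Nf y₀ * (g.inducedMetric f hpb hfi).normSq y₀ (g.secondFundamentalForm I' f ν y₀) := by
  haveI := (g.inducedMetric f hpb hfi).hasLeviCivita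
  haveI : FiniteDimensional ℝ (TangentSpace I' y₀) := inferInstanceAs (FiniteDimensional ℝ E')
  set gN := g.inducedMetric f hpb hfi with hgN
  set K : LinearMap.BilinForm ℝ (TangentSpace I' y₀) := g.secondFundamentalForm I' f ν y₀ with hK
  set A : TangentSpace I' y₀ →ₗ[ℝ] TangentSpace I' y₀ :=
    ((gN.leviCivita Z y₀ : TangentSpace I' y₀ →L[ℝ] TangentSpace I' y₀) :
      TangentSpace I' y₀ →ₗ[ℝ] TangentSpace I' y₀) with hA
  have hf : ContMDiff I' I ∞ f := IsSpacelikeImmersion.contMDiff_self hfi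
  have hf2 : ContMDiff I' I 2 f := hf.of_le (by exact WithTop.coe_le_coe.2 le_top)
  have hν1 : ContMDiff I' I.tangent 1
      (fun x ↦ (TotalSpace.mk' E (f x) (ν x) : TangentBundle I M)) :=
    hν.of_le (by exact WithTop.coe_le_coe.2 le_top)
  -- `K` is symmetric
  have hKflip : K.flip = K := by
    refine LinearMap.ext₂ fun v w ↦ ?_
    change K w v = K v w
    exact ((secondFundamentalForm_symm_holds (g := g) (I' := I') hf2 hun.isNormalTo hν1
      (y := y₀) BoundarylessManifold.isInteriorPoint).eq w v)
  -- `B(u, w) = h(∇_u Z, w)`, `♯B = ∇Z`, `B + Bᵗ = -2N K`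
  set B : LinearMap.BilinForm ℝ (TangentSpace I' y₀) := (gN.toBilinForm y₀).comp A LinearMap.id
    with hB
  have hB_apply : ∀ u w, B u w = gN.val y₀ (gN.leviCivita Z y₀ u) w := fun u w ↦ rfl
  have hsharpB : (gN.sharp y₀).toLinearMap ∘ₗ B = A := by
    ext u
    rw [LinearMap.comp_apply, LinearEquiv.coe_coe]
    exact gN.sharp_eq_of_forall y₀ (B u) (A u) fun w ↦ (hB_apply u w).symm
  have hBK : B + B.flip = (-2 * Nf y₀) • K := by
    refine LinearMap.ext₂ fun u w ↦ ?_
    change B u w + B w u = (-2 * Nf y₀) * K u w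
    rw [hB_apply, hB_apply]
    exact hX.inducedMetric_val_leviCivita_shift_symm_add g hpb hfi hν hun.isNormalTo hNd hZ
      hsplit y₀ u w
  have hmain := gN.trace_sharp_comp_sharp_of_add_flip_eq y₀ hKflip hBK
  rw [LinearMap.comp_assoc, hsharpB] at hmain
  rw [hmain]
  ring

/-- **The Sudarsky–Wald integrand: `D_i(K^{ij} Z_j) = -N K^{ij} K_{ij}` on a maximal vacuum slice**
(Chruściel–Costa 2008, §7.2, the display after (7.1): "It is well known that maximality of `Σ''`
and the vacuum scalar constraint equation imply that `D_i(K^{ij} Z_j) = -N K^{ij} K_{ij}`").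
Setting: a spacelike hypersurface `f : (Nᵐ, h = f^*g) → (Mᵐ⁺¹, g)` with unit normal `ν` of sign
`ε ≠ 0` (smooth lift); a Killing field `X` with `X ∘ f = Nf ν + df Z` (lapse `Nf`, shift `Z`,
differentiable); a field of continuous bilinear forms `Kc` agreeing with the second fundamental
form `K = g(Dν, df ·)` and differentiable at `y₀` (as in `HypersurfaceMomentumConstraint.lean`); the
vector field `W = ♯(K(·, Z))` (`h(W, u) = K(u, Z)`), differentiable at `y₀`; the slice maximal
(`tr_h K ≡ 0`, `meanCurvature`) and `Ric_g = 0` at `f y₀`. Then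
`div_h W (y₀) = -Nf(y₀) |K_{y₀}|²_h`. Proof: `div W = (div K)(Z) + tr(♯Kᵗ ∘ ∇Z)`
(`vectorDivergence_sharp_contract`); `(div K)(Z) = d(tr K)(Z) + Ric(df Z, ν) = 0` by the momentum
constraint (`divergence_sub_mvfderiv_meanCurvature_eq_zero`) and maximality; and
`tr(♯K ∘ ∇Z) = -Nf |K|²` by the previous lemma (`K` symmetric). [cite: ChruscielCosta2008, §7.2 (display after (7.1))] -/
theorem IsKillingField.vectorDivergence_sharp_secondFundamentalForm_shift
    {ν : NormalField I f} {ε : ℝ}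
    (hν : ContMDiff I' I.tangent ∞ (fun x ↦ (TotalSpace.mk' E (f x) (ν x) : TangentBundle I M)))
    (hun : g.IsUnitNormal I' f ν ε) (hε : ε ≠ 0)
    {m : ℕ} (hm : Module.finrank ℝ E' = m) (hm1 : Module.finrank ℝ E = m + 1)
    {X : Π x : M, TangentSpace I x} (hX : g.IsKillingField X)
    {Nf : N → ℝ} (hNd : ∀ y, MDifferentiableAt I' 𝓘(ℝ, ℝ) Nf y)
    {Z : Π y : N, TangentSpace I' y} (hZ : ∀ y, MDiffAt (T% Z) y)
    (hsplit : ∀ y, X (f y) = Nf y • ν y + mfderiv I' I f y (Z y))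
    (Kc : Π y : N, TangentSpace I' y →L[ℝ] TangentSpace I' y →L[ℝ] ℝ)
    (hKc : ∀ (y : N) (v w : TangentSpace I' y), Kc y v w = g.secondFundamentalForm I' f ν y v w)
    {y₀ : N}
    (hKd : MDifferentiableAt I' (I'.prod 𝓘(ℝ, E' →L[ℝ] E' →L[ℝ] ℝ))
      (fun y ↦ TotalSpace.mk' (E' →L[ℝ] E' →L[ℝ] ℝ)
        (E := fun y : N ↦ TangentSpace I' y →L[ℝ] TangentSpace I' y →L[ℝ] ℝ) y (Kc y)) y₀)
    {W : Π y : N, TangentSpace I' y} (hW : MDiffAt (T% W) y₀)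
    (hWK : ∀ (y : N) (u : TangentSpace I' y), (g.inducedMetric f hpb hfi).val y (W y) u = Kc y u (Z y))
    (hmax : ∀ y, g.meanCurvature f hpb hfi ν y = 0) (hRic : g.ricci (f y₀) = 0) :
    haveI := (g.inducedMetric f hpb hfi).hasLeviCivita
    (g.inducedMetric f hpb hfi).vectorDivergence W y₀ =
      -Nf y₀ * (g.inducedMetric f hpb hfi).normSq y₀ (g.secondFundamentalForm I' f ν y₀) := by
  haveI := (g.inducedMetric f hpb hfi).hasLeviCivita
  haveI : FiniteDimensional ℝ (TangentSpace I' y₀) := inferInstanceAs (FiniteDimensional ℝ E')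
  set gN := g.inducedMetric f hpb hfi with hgN
  -- the Leibniz rule
  have hA := gN.vectorDivergence_sharp_contract hKd (hZ y₀) hW hWK
  -- the momentum constraint on a maximal slice of a vacuum spacetime: `(div K)(Z) = 0`
  have hdiv : gN.divergence Kc y₀ (Z y₀) = 0 := by
    have hmom := g.divergence_sub_mvfderiv_meanCurvature_eq_zero hpb hfi hν hun hε hm hm1 Kc hKc
      y₀ hKd hRic (Z y₀)
    have hH : g.meanCurvature f hpb hfi ν = fun _ ↦ (0 : ℝ) := funext hmax
    rw [hH, mvfderiv_const] at hmom
    simpa using hmom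
  -- `Kc y₀ = K_{y₀}` as bilinear forms, symmetric
  have hKb : (Kc y₀).toLinearMap₁₂ = g.secondFundamentalForm I' f ν y₀ :=
    LinearMap.ext₂ fun v w ↦ by rw [ContinuousLinearMap.toLinearMap₁₂_apply, hKc]
  have hf : ContMDiff I' I ∞ f := IsSpacelikeImmersion.contMDiff_self hfi
  have hf2 : ContMDiff I' I 2 f := hf.of_le (by exact WithTop.coe_le_coe.2 le_top)
  have hν1 : ContMDiff I' I.tangent 1
      (fun x ↦ (TotalSpace.mk' E (f x) (ν x) : TangentBundle I M)) :=
    hν.of_le (by exact WithTop.coe_le_coe.2 le_top)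
  have hKflip : LinearMap.flip (g.secondFundamentalForm I' f ν y₀) =
      g.secondFundamentalForm I' f ν y₀ := by
    refine LinearMap.ext₂ fun v w ↦ ?_
    rw [LinearMap.flip_apply]
    exact ((secondFundamentalForm_symm_holds (g := g) (I' := I') hf2 hun.isNormalTo hν1
      (y := y₀) BoundarylessManifold.isInteriorPoint).eq w v)
  rw [hA, hdiv, zero_add, hKb, hKflip]
  exact hX.trace_sharp_secondFundamentalForm_comp_leviCivita_shift g hpb hfi hν hun hNd hZ hsplit y₀

end Slice

end PseudoRiemannianMetric

end Literature.Geometry.Lorentzian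

end
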